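import Summits.AtomisticToContinuum.FouriersLaw.Theorems.LocalEnergyHalfHoelder.Negative.UniformOscillationArena

/-!
# `LocalEnergyHalfHoelder` (stmt-AtomisticToContinuum-16008): the DLR–Gibbs guard is load-bearing —
# the uniform-oscillation arena

Negative lemma (refuter / crux disprover, load-bearing analysis, 2026-08-17) for the crux
`Summit.AtomisticToContinuum.FouriersLaw.Theses.HoelderEscapeProfile.LocalEnergyHalfHoelder`
(K1 of route `HoelderEscapeProfile`, sub-problem `FouriersLaw`): the Abel-mean on-site energy return
`Ψ(ν) = ν∫₀^∞e^{-νt}Cov_μ(h_0, h_0∘φ_t)dt ≤ C√ν` for every GUARDED arena `(μ, D)` of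
`pinnedChain ω₂ lam β γ` — `μ` a DLR Gibbs state at temperature `T`, shift- and momentum-reversal-
invariant, `D` an `InfiniteChainDynamics` preserving `μ` whose flow commutes with the shift `μ`-a.e.

The frozen arena (`δ_0`, `φ_t = id`; `FrozenFlowExcluded.lean`, `FibreCalculus/Negative/FalseWithoutGibbs.lean`)
does NOT test K1: there `S ≡ 0` and K1 holds. The cheapest arena on which K1's conclusion FAILS
while every guard except the DLR equations HOLDS needs genuine motion with a conserved local
quantity. We build it (everything proved, no named facts, no sorries):

* §1 the one-body Duffing oscillator `q̈ = -U'(q)`, `U(q) = ω₂q²/2 + lam q⁴/4`, through the tree's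
  cut-off Newtonian flow (`NewtonianFlow.cutoffFlow`, cut-off radius `1` in position): the cut-off
  force is a gradient in one degree of freedom (`Vt = ∫(-g)`), its energy `Ht` is conserved
  (`Ht_Φ`), and below the rim `U(1)` the position stays in `(-1, 1)` where the cut-off is inactive —
  so the shell `{p²/2 + U(q) < U(1)}` is invariant, carries TRUE Duffing orbits, and the true energy
  is conserved on it (`shell_invariant`); Liouville (tree: `IsSolutionFamily.measurePreserving`)
  restricted to the shell (`measurePreserving_Φ_restrict`).
* §2 the UNIFORM-OSCILLATION DYNAMICS `unifDynamics : InfiniteChainDynamics (pinnedChain ω₂ lam β γ)`: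
  carrier = spatially uniform configurations with one-body datum in the shell, flow = the same
  Duffing orbit at every site (bond forces `V'(0) - V'(0)` vanish identically: genuine solutions of
  LLL (1a)–(1b)); uniqueness within the carrier = Picard–Lindelöf for the cut-off field.
* §3 the UNIFORM STATE `μu` = normalised Liouville measure of the shell pushed to uniform
  configurations: a probability measure, shift-invariant (uniform configurations are shift-fixed),
  reversal-invariant (`p ↦ -p` preserves Lebesgue measure and the shell), preserved by `unifDynamics`
  (Liouville on the shell), whose flow commutes with the shift on the carrier.
* §4 on this arena `S(0,t) = Cov(h_0, h_0∘φ_t) = Var(h_0) =: v > 0` for EVERY `t` (the site energy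
  `h_0 = p²/2 + U(q)` is conserved along uniform orbits; `v > 0` because the one-body energy is not
  Lebesgue-a.e. constant on the open shell): an ATOM of the site-energy spectral measure at `0`,
  `Ψ(ν) = v ≰ C√ν` — `uniform_arena`, `localEnergyHalfHoelder_false_without_isChainGibbsMeasure`.
* §5 which consequence of DLR kills the arena: a DLR state gives the coincidence `{σ 0 = σ 1}`
  probability `0` (`gibbs_coincidence_null`, one-site kernel ≪ Lebesgue), the uniform state gives it
  probability `1`; `not_isChainGibbsMeasure_μu`.

READING FOR PROVERS. Any proof of K1 must use the DLR equations of `μ` beyond "probability +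
invariances + an honest measure-preserving Hamiltonian flow": it must exclude invariant states
concentrated near the flow-invariant subspace of spatially uniform configurations (zero current,
conserved site energy) — quantitatively, K1 is a statement about how fast the true Gibbs dynamics
DEPHASES neighbouring sites that start almost in phase. The arena is also the `N = ∞` shadow of the
`k = 0` mode: on uniform data the pinned chain is an ensemble of uncoupled identical clocks.
No statement of the route is asserted here.
-/

noncomputable section

open MeasureTheory Filter Set Metric
open scoped NNReal ENNReal

namespace Summit.AtomisticToContinuum.FouriersLaw.Theorems.LocalEnergyHalfHoelder.Negative.FalseWithoutGibbs

open Literature.MathematicalPhysics.KineticTheory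
open Literature.MathematicalPhysics.KineticTheory.HeatConduction
open Literature.MathematicalPhysics.KineticTheory.NewtonianFlow
open Summit.AtomisticToContinuum.FouriersLaw.Theorems.LocalEnergyHalfHoelder.Negative.UniformOscillationFlow
open Summit.AtomisticToContinuum.FouriersLaw.Theorems.LocalEnergyHalfHoelder.Negative.UniformOscillationArena

variable {ω₂ lam : ℝ}

/-! ### The on-site energy autocovariance of the uniform state is a positive constant -/

variable (ω₂ lam)

/-- The split-bond site energy of `pinnedChain ω₂ lam β γ` (the `h` of the crux, verbatim). [folklore] -/
def siteE (β γ : ℝ) (σ : ChainConfig) (x : ℤ) : ℝ :=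
  (σ x).2 ^ 2 / 2 + (pinnedChain ω₂ lam β γ).U (σ x).1 +
    ((pinnedChain ω₂ lam β γ).V ((σ (x + 1)).1 - (σ x).1) +
      (pinnedChain ω₂ lam β γ).V ((σ x).1 - (σ (x - 1)).1)) / 2

variable {ω₂ lam}

/-- Auxiliary (`siteE_embed`), see the module docstring. [folklore] -/
theorem siteE_embed (β γ : ℝ) (z : PhaseSpace 1) (x : ℤ) :
    siteE ω₂ lam β γ (embed z) x = Hd ω₂ lam z := by
  simp [siteE, Hd, pinnedChain_U, pinnedChain_V_zero]

/-- Auxiliary (`continuous_pinnedChain_V`), see the module docstring. [folklore] -/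
theorem continuous_pinnedChain_V (β γ : ℝ) : Continuous (pinnedChain ω₂ lam β γ).V := by
  show Continuous fun r : ℝ => r ^ 2 / 2 + β * r ^ 4 / 4
  fun_prop

/-- Auxiliary (`measurable_siteE_zero`), see the module docstring. [folklore] -/
theorem measurable_siteE_zero (β γ : ℝ) : Measurable fun σ : ChainConfig => siteE ω₂ lam β γ σ 0 := by
  have hU : Measurable (pinnedChain ω₂ lam β γ).U := by
    rw [pinnedChain_U]; exact (continuous_Upin ω₂ lam).measurable
  have hV : Measurable (pinnedChain ω₂ lam β γ).V := (continuous_pinnedChain_V β γ).measurable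
  have h0 : Measurable fun σ : ChainConfig => σ 0 := measurable_pi_apply 0
  have h1 : Measurable fun σ : ChainConfig => σ (0 + 1) := measurable_pi_apply (0 + 1)
  have hm1 : Measurable fun σ : ChainConfig => σ (0 - 1) := measurable_pi_apply (0 - 1)
  unfold siteE
  exact (((h0.snd.pow_const 2).div_const 2).add (hU.comp h0.fst)).add
    (((hV.comp (h1.fst.sub h0.fst)).add (hV.comp (h0.fst.sub hm1.fst))).div_const 2)

/-- Along the uniform dynamics the on-site energy is conserved on the carrier, so the
autocovariance integrand is `μu`-a.e. the squared fluctuation. [folklore] -/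
theorem covariance_eq_variance (hω : 0 ≤ ω₂) (hl : 0 ≤ lam) (β γ m t : ℝ) :
    ∫ σ, (siteE ω₂ lam β γ σ 0 - m) *
        (siteE ω₂ lam β γ ((unifDynamics hω hl β γ).flow t σ) 0 - m) ∂(μu ω₂ lam)
      = ∫ z, (Hd ω₂ lam z - m) ^ 2 ∂(ρ ω₂ lam) := by
  have hG : Measurable fun σ : ChainConfig => (siteE ω₂ lam β γ σ 0 - m) *
      (siteE ω₂ lam β γ ((unifDynamics hω hl β γ).flow t σ) 0 - m) := by
    refine ((measurable_siteE_zero β γ).sub_const m).mul ?_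
    have : (fun σ : ChainConfig => siteE ω₂ lam β γ ((unifDynamics hω hl β γ).flow t σ) 0 - m) =
        fun σ => Hd ω₂ lam (Φ ω₂ lam t (proj σ)) - m := by
      funext σ; simp [siteE_embed]
    rw [this]
    exact ((continuous_Hd ω₂ lam).measurable.comp ((measurable_Φ t).comp measurable_proj)).sub_const m
  unfold μu
  rw [integral_map measurable_embed.aemeasurable hG.aestronglyMeasurable]
  refine integral_congr_ae ?_
  filter_upwards [ae_ρ_mem_shell] with z hz
  simp only [unifDynamics_flow, proj_embed, siteE_embed]
  rw [(shell_invariant hω hl hz t).1]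
  ring

/-- The one-body energy is not `ρ`-a.s. constant: the variance integral is positive. [folklore] -/
theorem variance_pos (hω : 0 < ω₂) (hl : 0 ≤ lam) (m : ℝ) :
    0 < ∫ z, (Hd ω₂ lam z - m) ^ 2 ∂(ρ ω₂ lam) := by
  set f : PhaseSpace 1 → ℝ := fun z => (Hd ω₂ lam z - m) ^ 2 with hf
  have hfc : Continuous f := ((continuous_Hd ω₂ lam).sub continuous_const).pow 2
  rw [ρ_def, integral_smul_measure, smul_eq_mul]
  refine mul_pos ?_ ?_
  · exact ENNReal.toReal_pos (ENNReal.inv_ne_zero.mpr (volume_shell_ne_top hω.le hl))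
      (ENNReal.inv_ne_top.mpr (volume_shell_ne_zero hω hl))
  · have hint : IntegrableOn f (shell ω₂ lam) volume :=
      (hfc.continuousOn.integrableOn_compact (isCompact_closedBall _ _)).mono_set
        (shell_subset_closedBall hω.le hl)
    rw [integral_pos_iff_support_of_nonneg_ae (Eventually.of_forall fun z => sq_nonneg _) hint,
      Measure.restrict_apply' (measurableSet_shell ω₂ lam)]
    have hopen : IsOpen (Function.support f ∩ shell ω₂ lam) :=
      (isOpen_compl_singleton.preimage hfc).inter (isOpen_shell ω₂ lam)
    -- a point of the shell where the fluctuation is non-zero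
    obtain ⟨z₀, hz₀, hfz₀⟩ : ∃ z₀ ∈ shell ω₂ lam, f z₀ ≠ 0 := by
      by_cases hm : m = 0
      · refine ⟨((0 : Fin 1 → ℝ), vec (Real.sqrt (Upin ω₂ lam 1))), ?_, ?_⟩
        · show (Real.sqrt (Upin ω₂ lam 1)) ^ 2 / 2 + Upin ω₂ lam ((0 : Fin 1 → ℝ) 0) < Upin ω₂ lam 1
          rw [Real.sq_sqrt (Upin_one_pos hω hl).le]
          simp only [Pi.zero_apply, Upin_zero, add_zero]
          linarith [Upin_one_pos hω hl]
        · simp only [hf, hm, sub_zero, Hd, vec_apply, Pi.zero_apply, Upin_zero, add_zero,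
            Real.sq_sqrt (Upin_one_pos hω hl).le, ne_eq]
          have := Upin_one_pos hω hl
          positivity
      · refine ⟨0, zero_mem_shell hω hl, ?_⟩
        simp [hf, Hd, hm]
    exact hopen.measure_pos volume ⟨z₀, hfz₀, hz₀⟩

/-- A positive constant Abel profile is not `½`-Hölder at `0`. [folklore] -/
theorem not_halfHoelder_of_const_pos {v : ℝ} (hv : 0 < v) {C ν₀ : ℝ} (hν₀ : 0 < ν₀)
    (h : ∀ ν : ℝ, 0 < ν → ν ≤ ν₀ → v ≤ C * Real.sqrt ν) : False := by
  rcases le_or_gt C 0 with hC0 | hC0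
  · have h1 := h ν₀ hν₀ le_rfl
    nlinarith [Real.sqrt_nonneg ν₀]
  · have hq : 0 < v / (2 * C) := by positivity
    set ν := min ν₀ ((v / (2 * C)) ^ 2) with hν
    have hνpos : 0 < ν := lt_min hν₀ (by positivity)
    have h1 := h ν hνpos (min_le_left _ _)
    have h2 : Real.sqrt ν ≤ v / (2 * C) := by
      rw [← Real.sqrt_sq hq.le]
      exact Real.sqrt_le_sqrt (min_le_right _ _)
    have h3 : C * Real.sqrt ν ≤ C * (v / (2 * C)) := mul_le_mul_of_nonneg_left h2 hC0.le
    have h4 : C * (v / (2 * C)) = v / 2 := by field_simp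
    linarith

/-- The Abel mean of a constant profile: `ν ∫₀^∞ e^{-νt} v dt = v`. [folklore] -/
theorem abelMean_const {ν : ℝ} (hν : 0 < ν) (v : ℝ) :
    ν * ∫ t in Ioi (0:ℝ), Real.exp (-(ν * t)) * v = v := by
  have h2 : ∫ t in Ioi (0:ℝ), Real.exp (-ν * t) = -Real.exp (-ν * 0) / -ν :=
    integral_exp_mul_Ioi (neg_lt_zero.mpr hν) 0
  rw [mul_zero, Real.exp_zero, neg_div_neg_eq] at h2
  simp only [neg_mul] at h2
  rw [integral_mul_const, h2]
  field_simp

/-! ### The arena and the negative lemma -/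

/-- **The uniform-oscillation arena.** For every `ω₂ > 0`, `lam ≥ 0` and all `β, γ` there are a
probability measure `μ` on chain configurations and an `InfiniteChainDynamics` `D` of
`pinnedChain ω₂ lam β γ` satisfying EVERY guard of `LocalEnergyHalfHoelder` except the DLR
equations — `μ` is shift- and momentum-reversal-invariant, `D` preserves `μ` (carrier conull,
every `φ_t` measure preserving) and commutes with the shift `μ`-a.e. — for which the on-site energy
autocovariance `S(0,t) = Cov_μ(h_0, h_0 ∘ φ_t)` is a POSITIVE CONSTANT `v` (an atom of the
site-energy spectral measure at frequency `0`): `μ` = normalised Liouville measure of the one-body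
energy shell `{p²/2 + U(q) < U(1)}` carried by spatially uniform configurations, `D` = the uniform
Duffing oscillation `q̈ = -U'(q)` at every site (bond forces vanish identically, the site energy is
conserved along every orbit of the carrier). [folklore] -/
theorem uniform_arena (hω : 0 < ω₂) (hl : 0 ≤ lam) (β γ : ℝ) :
    ∃ (μ : Measure ChainConfig) (D : InfiniteChainDynamics (pinnedChain ω₂ lam β γ)) (v : ℝ),
      IsProbabilityMeasure μ ∧ IsShiftInvariant μ ∧
      μ.map (fun σ : ChainConfig => fun x : ℤ => ((σ x).1, -(σ x).2)) = μ ∧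
      D.PreservesMeasure μ ∧ (∀ t : ℝ, ∀ᵐ σ ∂μ, D.flow t (shift σ) = shift (D.flow t σ)) ∧
      0 < v ∧ ∀ t : ℝ, ∫ σ, (siteE ω₂ lam β γ σ 0 - ∫ σ', siteE ω₂ lam β γ σ' 0 ∂μ) *
          (siteE ω₂ lam β γ (D.flow t σ) 0 - ∫ σ', siteE ω₂ lam β γ σ' 0 ∂μ) ∂μ = v := by
  refine ⟨μu ω₂ lam, unifDynamics hω.le hl β γ, _, isProbabilityMeasure_μu hω hl,
    isShiftInvariant_μu, reversal_μu, preservesMeasure_unifDynamics hω.le hl β γ,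
    shift_comm_unifDynamics hω.le hl β γ, variance_pos hω hl (∫ σ', siteE ω₂ lam β γ σ' 0 ∂(μu ω₂ lam)),
    fun t => covariance_eq_variance hω.le hl β γ _ t⟩

/-- **`LocalEnergyHalfHoelder` is false without the Gibbs (DLR) hypothesis.** The displayed
statement is `HoelderEscapeProfile.LocalEnergyHalfHoelder` (stmt-AtomisticToContinuum-16008)
VERBATIM except that the guard `(pinnedChain ω₂ lam β γ).IsChainGibbsMeasure T μ` is replaced by
`IsProbabilityMeasure μ`; it is refuted at `ω₂ = lam = β = T = 1`, `γ = 0` by the uniform-oscillation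
arena (`uniform_arena`): there `S(0,t) ≡ v > 0`, the Abel-integrability guard holds, and
`ν∫₀^∞e^{-νt}S(0,t)dt = v ≰ C√ν` as `ν ↓ 0`. So any proof of K1 must use the DLR equations — among
the guards only they exclude invariant states carried by the flow-invariant set of spatially
uniform configurations, on which the site energy is a conserved quantity (a DLR state gives the
event `{σ 0 = σ 1}` probability `0`, cf. `FrozenFlowExcluded.gibbs_momentum_zero_null` for the
analogous null event of the frozen arena, which is NOT a witness here since it has `S ≡ 0`). [folklore] -/
theorem localEnergyHalfHoelder_false_without_isChainGibbsMeasure :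
    ¬ (∀ ω₂ lam β γ : ℝ, 0 < ω₂ → 0 < lam → 0 < β → ∀ T : ℝ, 0 < T → ∀ μ : MeasureTheory.Measure Literature.MathematicalPhysics.KineticTheory.HeatConduction.ChainConfig, MeasureTheory.IsProbabilityMeasure μ → Literature.MathematicalPhysics.KineticTheory.HeatConduction.IsShiftInvariant μ → μ.map (fun σ : Literature.MathematicalPhysics.KineticTheory.HeatConduction.ChainConfig => fun x : ℤ => ((σ x).1, -(σ x).2)) = μ → ∀ D : Literature.MathematicalPhysics.KineticTheory.HeatConduction.InfiniteChainDynamics (Literature.MathematicalPhysics.KineticTheory.HeatConduction.pinnedChain ω₂ lam β γ), D.PreservesMeasure μ → (∀ t : ℝ, ∀ᵐ σ ∂μ, D.flow t (Literature.MathematicalPhysics.KineticTheory.HeatConduction.shift σ) = Literature.MathematicalPhysics.KineticTheory.HeatConduction.shift (D.flow t σ)) → ∀ h : Literature.MathematicalPhysics.KineticTheory.HeatConduction.ChainConfig → ℤ → ℝ, h = (fun (σ : Literature.MathematicalPhysics.KineticTheory.HeatConduction.ChainConfig) (x : ℤ) => (σ x).2 ^ 2 / 2 + (Literature.MathematicalPhysics.KineticTheory.HeatConduction.pinnedChain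 ω₂ lam β γ).U (σ x).1 + ((Literature.MathematicalPhysics.KineticTheory.HeatConduction.pinnedChain ω₂ lam β γ).V ((σ (x + 1)).1 - (σ x).1) + (Literature.MathematicalPhysics.KineticTheory.HeatConduction.pinnedChain ω₂ lam β γ).V ((σ x).1 - (σ (x - 1)).1)) / 2) → ∀ S : ℤ → ℝ → ℝ, S = (fun (x : ℤ) (t : ℝ) => ∫ σ, (h σ 0 - ∫ σ', h σ' 0 ∂μ) * (h (D.flow t σ) x - ∫ σ', h σ' 0 ∂μ) ∂μ) → (∀ ν : ℝ, 0 < ν → MeasureTheory.IntegrableOn (fun t : ℝ => Real.exp (-(ν * t)) * S 0 t) (Set.Ioi 0)) → ∃ C ν₀ : ℝ, 0 < ν₀ ∧ ∀ ν : ℝ, 0 < ν → ν ≤ ν₀ → ν * ∫ t in Set.Ioi (0:ℝ), Real.exp (-(ν * t)) * S 0 t ≤ C * Real.sqrt ν) := by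
  intro H
  obtain ⟨μ, D, v, hP, hSI, hR, hPres, hComm, hv, hS⟩ := uniform_arena (ω₂ := 1) (lam := 1) one_pos zero_le_one 1 0
  haveI := hP
  obtain ⟨C, ν₀, hν₀, hC⟩ := H 1 1 1 0 one_pos one_pos one_pos 1 one_pos μ hP hSI hR D hPres hComm
    (siteE 1 1 1 0) rfl _ rfl (fun ν hν => by
      show IntegrableOn (fun t : ℝ => Real.exp (-(ν * t)) *
        ∫ σ, (siteE 1 1 1 0 σ 0 - ∫ σ', siteE 1 1 1 0 σ' 0 ∂μ) *
          (siteE 1 1 1 0 (D.flow t σ) 0 - ∫ σ', siteE 1 1 1 0 σ' 0 ∂μ) ∂μ) (Ioi 0)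
      simp_rw [hS]
      have h3 : IntegrableOn (fun t : ℝ => Real.exp (-ν * t)) (Ioi 0) := exp_neg_integrableOn_Ioi 0 hν
      have h4 : IntegrableOn (fun t : ℝ => Real.exp (-ν * t) * v) (Ioi 0) := h3.mul_const v
      have h5 : (fun t : ℝ => Real.exp (-(ν * t)) * v) = fun t => Real.exp (-ν * t) * v := by
        funext t; rw [neg_mul]
      rw [h5]; exact h4)
  refine not_halfHoelder_of_const_pos hv (C := C) hν₀ fun ν hν hle => ?_
  have h := hC ν hν hle
  change ν * ∫ t in Ioi (0:ℝ), Real.exp (-(ν * t)) *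
      ∫ σ, (siteE 1 1 1 0 σ 0 - ∫ σ', siteE 1 1 1 0 σ' 0 ∂μ) *
        (siteE 1 1 1 0 (D.flow t σ) 0 - ∫ σ', siteE 1 1 1 0 σ' 0 ∂μ) ∂μ ≤ C * Real.sqrt ν at h
  simp_rw [hS] at h
  rwa [abelMean_const hν] at h


/-! ### Which consequence of the DLR equations excludes the arena -/

/-- Under ANY DLR state of an oscillator chain the two-site coincidence `σ 0 = σ 1` is a null
event: the one-site kernel at `Λ = {0}` is a tilt of the image of Lebesgue measure, which does not
charge the point `η 1`. [folklore] -/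
theorem gibbs_coincidence_null (P : OscillatorChain) (T : ℝ) (μ : Measure ChainConfig)
    (hG : P.IsChainGibbsMeasure T μ) : μ {σ | σ 0 = σ 1} = 0 := by
  classical
  set A : Set ChainConfig := {σ | σ 0 = σ 1} with hAdef
  have hA : MeasurableSet A := measurableSet_eq_fun (measurable_pi_apply 0) (measurable_pi_apply 1)
  have hDLR := hG.2 ({0} : Finset ℤ) A hA
  have h0 : (0:ℤ) ∈ ({0} : Finset ℤ) := Finset.mem_singleton_self 0
  have hzero : ∀ η : ChainConfig, P.chainSpecification T {0} η A = 0 := by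
    intro η
    show Literature.Probability.LatticeModels.gibbsSpecOfPotential _ _ _ _ {0} η A = 0
    unfold Literature.Probability.LatticeModels.gibbsSpecOfPotential
    refine (tilted_absolutelyContinuous _ _) ?_
    rw [Measure.map_apply (Literature.Probability.LatticeModels.measurable_glueWith _ η) hA]
    have hpre : (fun ζ : (↥({0} : Finset ℤ)) → ℝ × ℝ =>
        Literature.Probability.LatticeModels.glueWith ({0} : Finset ℤ) ζ η) ⁻¹' A
        = Function.eval (⟨0, h0⟩ : ↥({0} : Finset ℤ)) ⁻¹' ({η 1} : Set (ℝ × ℝ)) := by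
      ext ζ
      simp [A, h0]
    rw [hpre]
    exact Measure.pi_eval_preimage_null _ (measure_singleton _)
  simp only [hzero, lintegral_zero] at hDLR
  exact hDLR.symm

/-- The uniform state charges the coincidence event fully. [folklore] -/
theorem μu_coincidence_eq_one (hω : 0 < ω₂) (hl : 0 ≤ lam) : μu ω₂ lam {σ | σ 0 = σ 1} = 1 := by
  haveI := isProbabilityMeasure_μu hω hl
  have hA : MeasurableSet {σ : ChainConfig | σ 0 = σ 1} :=
    measurableSet_eq_fun (measurable_pi_apply 0) (measurable_pi_apply 1)
  have h1 : ∀ᵐ σ ∂(μu ω₂ lam), σ ∈ {σ : ChainConfig | σ 0 = σ 1} :=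
    ae_μu_mem_carrier.mono fun σ hσ => (hσ.1 1).symm
  rw [ae_iff] at h1
  rw [← prob_compl_eq_zero_iff hA, compl_setOf]
  exact h1

/-- One-site events of the uniform state are shell-Liouville probabilities of their traces. [folklore] -/
theorem μu_apply_le {A : Set ChainConfig} (hA : MeasurableSet A) :
    μu ω₂ lam A ≤ (volume (shell ω₂ lam))⁻¹ * volume (embed ⁻¹' A) := by
  unfold μu
  rw [Measure.map_apply measurable_embed hA, ρ_def, Measure.smul_apply, smul_eq_mul]
  gcongr
  exact Measure.restrict_le_self

/-- The momentum hyperplane `{p 0 = c}` of the one-body phase space is Lebesgue-null. [folklore] -/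
theorem volume_snd_hyperplane (c : ℝ) : volume {z : PhaseSpace 1 | z.2 0 = c} = 0 := by
  have hset : {z : PhaseSpace 1 | z.2 0 = c} = (univ : Set (Fin 1 → ℝ)) ×ˢ {p : Fin 1 → ℝ | p 0 = c} := by
    ext z; simp
  rw [hset, Measure.volume_eq_prod, Measure.prod_prod]
  have h0 : volume {p : Fin 1 → ℝ | p 0 = c} = 0 := by
    rw [volume_pi]; exact Measure.pi_hyperplane (fun _ : Fin 1 => (volume : Measure ℝ)) 0 c
  rw [h0, mul_zero]

/-- **The one-site DLR consequences used so far by the tree's negative files HOLD for the uniform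
state**: `μu {p_0 = 0} = 0` (cf. `FrozenFlowExcluded.gibbs_momentum_zero_null`, which kills the
frozen arena) … [folklore] -/
theorem μu_momentum_zero_null : μu ω₂ lam {σ | (σ 0).2 = 0} = 0 := by
  have hA : MeasurableSet {σ : ChainConfig | (σ 0).2 = 0} :=
    measurableSet_eq_fun (measurable_pi_apply 0).snd measurable_const
  refine nonpos_iff_eq_zero.1 ((μu_apply_le hA).trans (le_of_eq ?_))
  have : embed ⁻¹' {σ : ChainConfig | (σ 0).2 = 0} = {z : PhaseSpace 1 | z.2 0 = 0} := by
    ext z; simp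
  rw [this, volume_snd_hyperplane, mul_zero]

/-- … and `μu {σ 0 = v} = 0` for every value `v` (cf. `IsChainGibbsMeasure.measure_coord_eq_zero` of
`InfiniteChainAbelWitness`): one-site non-atomicity / absolute continuity of `μ` is NOT what K1
needs from DLR — the arena is excluded only by a genuinely TWO-site consequence
(`gibbs_coincidence_null` below), i.e. a proof of K1 must use the conditional structure of `μ`
across sites (decoupling of neighbours), not merely smoothness of its one-site law. [folklore] -/
theorem μu_coord_eq_null (v : ℝ × ℝ) : μu ω₂ lam {σ | σ 0 = v} = 0 := by
  have hA : MeasurableSet {σ : ChainConfig | σ 0 = v} :=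
    measurableSet_eq_fun (measurable_pi_apply 0) measurable_const
  refine nonpos_iff_eq_zero.1 ((μu_apply_le hA).trans (le_of_eq ?_))
  have hsub : embed ⁻¹' {σ : ChainConfig | σ 0 = v} ⊆ {z : PhaseSpace 1 | z.2 0 = v.2} := by
    intro z hz
    simp only [mem_preimage, mem_setOf_eq, embed_apply] at hz
    show z.2 0 = v.2
    rw [← hz]
  have h0 : volume (embed ⁻¹' {σ : ChainConfig | σ 0 = v}) = 0 :=
    measure_mono_null hsub (volume_snd_hyperplane v.2)
  rw [h0, mul_zero]

/-- Hence the uniform state is a DLR state of NO chain at NO temperature: this (and, among the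
guards of the crux, only this) is what excludes the arena. [folklore] -/
theorem not_isChainGibbsMeasure_μu (hω : 0 < ω₂) (hl : 0 ≤ lam) (P : OscillatorChain) (T : ℝ) :
    ¬ P.IsChainGibbsMeasure T (μu ω₂ lam) := by
  intro hG
  have h0 := gibbs_coincidence_null P T _ hG
  rw [μu_coincidence_eq_one hω hl] at h0
  exact one_ne_zero h0

end Summit.AtomisticToContinuum.FouriersLaw.Theorems.LocalEnergyHalfHoelder.Negative.FalseWithoutGibbs

end
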